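import Summits.ResolutionOfSingularities.ResolutionOfSingularities.Theses.WeightedInvariant
import Summits.ResolutionOfSingularities.ResolutionOfSingularities.Theorems.WeightedInvariantLocalWeightedDropGradingDescent
import Summits.ResolutionOfSingularities.ResolutionOfSingularities.Theorems.WeightedInvariantLocalWeightedDropUnitRoot
import Summits.ResolutionOfSingularities.ResolutionOfSingularities.Theorems.WeightedInvariantLocalWeightedDropSliceCyl
import Summits.ResolutionOfSingularities.ResolutionOfSingularities.Theorems.WeightedInvariantLocalWeightedDropTameSliceKappa
import Literature.AlgebraicGeometry.Resolution.CobordantVertexChart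

/-!
# `LocalWeightedDrop`, line `vertex-descent-weight-residues`: the off-vertex guard `c ≠ 0` of
# `stub_hornedRank` is load-bearing (negative-side support, drefute seat)

Crux `stmt-ResolutionOfSingularities-8899`
(`Summit.ResolutionOfSingularities.ResolutionOfSingularities.Theses.WeightedInvariant.LocalWeightedDrop`),
line `vertex-descent-weight-residues`, hardest stub `stub_hornedRank` of the lead's skeleton
`Cruxes/LocalWeightedDrop/Lines/vertex-descent-weight-residues.lean`.

`hornedRank_false_without_offVertex` negates `stub_hornedRank` with the single guard `c ≠ 0 →` DELETED
from its move clause (written inline, verbatim otherwise; only theorems are declared here).  It is FALSE,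
sorry-free: with the vertex `c = 0` admitted as a challenge point the tame disjunct is unavailable there
(it needs some `cᵢ ≠ 0`), the grading hypothesis holds (it is `stub_gradingDescent`, true at every point),
so the stub's wild disjunct must make the rank drop at the `s`-saturated VERTEX successor of every
singular germ; transporting exactly as in the lead's glue `LocalWeightedDrop_of` (tame branch through the
landed tame slice `stub_unitRoot` + `stub_tameSliceKappa` + `stub_sliceCyl` and the three monotonicities,
wild branch verbatim) yields the vertex-admitting form of the crux, which
`CobordantVertexChart.vertex_game_lost` refutes over every field (the vertex successor of a nonzero germ
in `𝔪²` is again a nonzero germ in `𝔪²`, so a rank-minimal singular germ has a singular vertex successor).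
Instantiated at `p = 2`, `k = AlgebraicClosure (ZMod 2)`.

Moral (already honoured by the skeleton, recorded for re-cuts): any re-statement of the hardest stub must
keep the challenge points on `B₊` (off the vertex); the `μ_D`-grading congruences do NOT exclude the vertex
(they hold there with equality `w·β = a + r`).
-/

set_option linter.dupNamespace false -- mandated namespace of this single-conjunct summit

namespace Summit.ResolutionOfSingularities.ResolutionOfSingularities.Theorems.LocalWeightedDrop.Negative

open Literature.AlgebraicGeometry.Resolution

/-- Refutes `stub_hornedRank` of line `vertex-descent-weight-residues` (crux `LocalWeightedDrop`,
stmt-ResolutionOfSingularities-8899) WITHOUT its off-vertex guard `c ≠ 0` [stub-hypothesis load-bearing]: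
with the vertex admitted the statement is false for `p = 2` already (every prime works); witness
mechanism = `CobordantVertexChart.vertex_game_lost` after the lead's own transport `LocalWeightedDrop_of`.
[folklore] -/
theorem hornedRank_false_without_offVertex :
    ¬ (∀ (p : ℕ), p.Prime → ∀ (k : Type) [Field k] [CharP k p] [IsAlgClosed k],
    ∃ ρ : (n : ℕ) → MvPowerSeries (Fin n) k → Ordinal.{0},
    (∀ (n : ℕ) (f : MvPowerSeries (Fin n) k) (Φ : Fin n → MvPowerSeries (Fin n) k),
      (∀ i, MvPowerSeries.constantCoeff (Φ i) = 0) →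
      IsUnit (Matrix.det (Matrix.of fun i j => MvPowerSeries.coeff (Finsupp.single j 1) (Φ i))) →
      ρ n (MvPowerSeries.subst Φ f) ≤ ρ n f) ∧
    (∀ (n : ℕ) (f u : MvPowerSeries (Fin n) k), MvPowerSeries.constantCoeff u ≠ 0 → ρ n (u * f) ≤ ρ n f) ∧
    (∀ (n : ℕ) (j : Fin (n + 1)) (h : MvPowerSeries (Fin n) k),
      ρ (n + 1) (MvPowerSeries.subst (fun m : Fin n => (MvPowerSeries.X (j.succAbove m) : MvPowerSeries (Fin (n + 1)) k)) h)
        ≤ ρ n h) ∧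
    ∀ (n : ℕ) (f : MvPowerSeries (Fin n) k),
      (f ≠ 0 ∧ MvPowerSeries.constantCoeff f = 0 ∧ ∀ i, MvPowerSeries.coeff (Finsupp.single i 1) f = 0) →
      ∃ (θ : Fin n → MvPowerSeries (Fin n) k) (w : Fin n → ℕ),
        (∀ i, MvPowerSeries.constantCoeff (θ i) = 0) ∧
        IsUnit (Matrix.det (Matrix.of fun i j => MvPowerSeries.coeff (Finsupp.single j 1) (θ i))) ∧
        (∃ i, 0 < w i) ∧
        ∀ (c : Fin n → k), (∀ i, w i = 0 → c i = 0) →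
        ∀ (a : ℕ) (g : MvPowerSeries (Fin (n + 1)) k),
          MvPowerSeries.subst (CobordantChart.chart w c) (MvPowerSeries.subst θ f) = MvPowerSeries.X 0 ^ a * g →
          ¬ (MvPowerSeries.X (0 : Fin (n + 1)) ∣ g) →
          (MvPowerSeries.constantCoeff g = 0 ∧ ∀ j, MvPowerSeries.coeff (Finsupp.single j 1) g = 0) →
          (∀ D : ℕ, (∀ i, c i ≠ 0 → D ∣ w i) → ∀ e : Fin (n + 1) →₀ ℕ, MvPowerSeries.coeff e g ≠ 0 →
            Finsupp.weight w (Finsupp.tail e) ≡ a + e 0 [MOD D]) →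
          ((∃ i : Fin n, c i ≠ 0 ∧ ¬ (p ∣ w i) ∧
              ρ n (MvPowerSeries.subst (fun j : Fin (n + 1) => if j = i.succ then (0 : MvPowerSeries (Fin n) k)
                else MvPowerSeries.X (Fin.predAbove i j)) g) < ρ n f) ∨
            ((∀ i : Fin n, c i ≠ 0 → p ∣ w i) ∧ ρ (n + 1) g < ρ n f))) := by
  intro h
  obtain ⟨ρ, hAut, hUnit, hCyl, hMove⟩ := h 2 Nat.prime_two (AlgebraicClosure (ZMod 2))
  apply CobordantVertexChart.vertex_game_lost (AlgebraicClosure (ZMod 2))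
  refine ⟨ρ, ?_⟩
  intro n f hf
  obtain ⟨θ, w, hθ0, hθdet, hwpos, hdrop⟩ := hMove n f hf
  refine ⟨θ, w, hθ0, hθdet, hwpos, ?_⟩
  intro c a g hfac hndvd hsing
  -- the crux-convention point (possibly the vertex!)
  set c' : Fin n → AlgebraicClosure (ZMod 2) := fun i => if 0 < w i then c i else 0 with hc'def
  have hconv : ∀ i, w i = 0 → c' i = 0 := by
    intro i hi
    simp [hc'def, hi]
  have hchart := CobordantChart.cruxChart_eq_chart (k := AlgebraicClosure (ZMod 2)) w c
  rw [hchart] at hfac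
  have hgrad := stub_gradingDescent (AlgebraicClosure (ZMod 2)) n (MvPowerSeries.subst θ f) w c' hconv a g hfac
  rcases hdrop c' hconv a g hfac hndvd hsing hgrad with ⟨i, hci, hpw, hlt⟩ | ⟨-, hlt⟩
  · -- tame point: slice drop, carried up to `g` by the landed tame slice and the monotonicities of `ρ`
    have hm : ((w i : ℕ) : AlgebraicClosure (ZMod 2)) ≠ 0 := by
      intro h0
      exact hpw ((CharP.cast_eq_zero_iff (AlgebraicClosure (ZMod 2)) 2 (w i)).mp h0)
    obtain ⟨r, hr1, hrw, hrsupp⟩ := stub_unitRoot (AlgebraicClosure (ZMod 2)) n i.succ (w i) hm (c' i) hci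
    obtain ⟨Φ, u, hΦ0, hΦdet, hu, hg⟩ :=
      stub_tameSliceKappa (AlgebraicClosure (ZMod 2)) n (MvPowerSeries.subst θ f) w c' hconv a g hfac i hci r hr1 hrw hrsupp
    rw [← stub_sliceCyl (AlgebraicClosure (ZMod 2)) n i g] at hg
    calc ρ (n + 1) g
        = ρ (n + 1) (u * MvPowerSeries.subst Φ (MvPowerSeries.subst
            (fun m : Fin n => (MvPowerSeries.X ((Fin.succ i).succAbove m) : MvPowerSeries (Fin (n + 1)) (AlgebraicClosure (ZMod 2))))
            (MvPowerSeries.subst (fun j : Fin (n + 1) => if j = i.succ then (0 : MvPowerSeries (Fin n) (AlgebraicClosure (ZMod 2)))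
              else MvPowerSeries.X (Fin.predAbove i j)) g))) := by rw [← hg]
      _ ≤ ρ (n + 1) (MvPowerSeries.subst Φ (MvPowerSeries.subst
            (fun m : Fin n => (MvPowerSeries.X ((Fin.succ i).succAbove m) : MvPowerSeries (Fin (n + 1)) (AlgebraicClosure (ZMod 2))))
            (MvPowerSeries.subst (fun j : Fin (n + 1) => if j = i.succ then (0 : MvPowerSeries (Fin n) (AlgebraicClosure (ZMod 2)))
              else MvPowerSeries.X (Fin.predAbove i j)) g))) := hUnit _ _ _ hu
      _ ≤ ρ (n + 1) (MvPowerSeries.subst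
            (fun m : Fin n => (MvPowerSeries.X ((Fin.succ i).succAbove m) : MvPowerSeries (Fin (n + 1)) (AlgebraicClosure (ZMod 2))))
            (MvPowerSeries.subst (fun j : Fin (n + 1) => if j = i.succ then (0 : MvPowerSeries (Fin n) (AlgebraicClosure (ZMod 2)))
              else MvPowerSeries.X (Fin.predAbove i j)) g)) := hAut _ _ Φ hΦ0 hΦdet
      _ ≤ ρ n (MvPowerSeries.subst (fun j : Fin (n + 1) => if j = i.succ then (0 : MvPowerSeries (Fin n) (AlgebraicClosure (ZMod 2)))
              else MvPowerSeries.X (Fin.predAbove i j)) g) := hCyl n i.succ _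
      _ < ρ n f := hlt
  · -- wild point (in particular the VERTEX): the stub's drop on the honest successor
    exact hlt

end Summit.ResolutionOfSingularities.ResolutionOfSingularities.Theorems.LocalWeightedDrop.Negative
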